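import Mathlib
import Literature.MathematicalPhysics.QuantumFieldTheory.BalabanImbrieJaffe1984to88.BIJ85Prop521Torus
import Literature.MathematicalPhysics.QuantumFieldTheory.BalabanImbrieJaffe1984to88.BIJ85Prop511Torus
import Literature.MathematicalPhysics.QuantumFieldTheory.BalabanImbrieJaffe1984to88.BIJ85Prop522Proof

/-!
# `BalabanImbrieJaffe1984to88.BIJ85Prop522Torus` — T. Bałaban, J. Imbrie, A. Jaffe, *Renormalization of the Higgs model:
minimizers, propagators and the stability of mean field theory*, Commun. Math. Phys. **97** (1985) 299–329
[BalabanImbrieJaffe1985]: **Proposition 5.2.2** (5.2.6)–(5.2.9) and Remark 1 (5.2.10), p. 316–317 [PDF 18–19], ON THE TORUS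
`T^{(0)}` — the MODEL INSTANCE of the row's abstract theorem `…BIJ85Prop522Proof.prop522_holds` (p11 gen 1) on p09/p30's
Euclidean operator framework of (4.1.1)/(5.2.1)–(5.2.2) (`BIJ85AxialPropagator411`, `BIJ85Prop521Proof/Torus`), with p11's Landau
minimizer (4.4.2) (`BIJ85LandauMinimizer442(V1)`) and p30's Proposition 5.1.1 / (5.2.8) on the torus (`BIJ85Prop511Torus`),
HYPOTHESIS-FREE in the standing range `k ≤ m + K`, `c ≠ 0`, `w > 0`

statement-level skeleton of published theorems with citation tags; proofs where landed; nothing here is a claim about the Yang–Mills mass gap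

PDF held: `paper:balaban1985-cmp97-bij-higgs-minimizers` (journal page = PDF page + 298); p. 316–317 [PDF 18–19] read (OCR text).

CITATION HEADER (lean-in-tree rule).  Phase-2 proof seat p11 (gen 3) of `lit-balaban` (HOME `run/shared/lean/pub/lit-balaban/`,
unit `lit-balaban-p11-g3`); SKELETON row **C1.Prop5.2.2** (decl of record: r15's `…BIJ85Sect4Statements.Prop522Data.Prop522`,
PROVED over the abstract carrier by p11 gen 1's `prop522_holds`; THIS file = kind «model-instance»), with the torus forms of
(5.2.8), (5.2.9) and Remark 1 (5.2.10) (row C1.Rem@317).  THE PRINTED TEXT, p. 316–317, verbatim: *"Now that we have related H_k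
and H_{k,Ax}, we can find the relation between 𝒟_k and G_{k,Ax}. In fact we need only the compositions 𝒟_k∂* and G_{k,Ax}∂*,
since only these products occur.  Proposition 5.2.2. There is a gauge transformation D such that G_{k,Ax}∂* − 𝒟_k∂* = ∂D.
(5.2.6)  Explicitly D = Σ_{j=0}^{k−1} λ_j(H_jC^{(j)}H_j*∂*), (5.2.7) where λ_j is the function of Proposition 5.1.1 with k set
equal to j. Here we write the operator identity, rather than the identity G_{k,Ax}∂*B = 𝒟_k∂*B + ∂DB for configurations.
Proof. We use three facts: the formula (5.2.1), the fact that H*_{j,Ax}∂* = H*_j∂*, (5.2.8) is gauge invariant, and formulas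
(5.1.1), (5.1.4) for the factor H_{j,Ax} − H_j in the expression G_{k,Ax}∂* − 𝒟_k∂* = Σ_{j=0}^{k−1} (H_{j,Ax} − H_j)C^{(j)}H_j*∂*.
(5.2.9)  Substitution then yields (5.2.7).  Remark 1. A consequence of the proposition is ∂G_{k,Ax}∂* = ∂𝒟_k∂*. (5.2.10)"*

WHAT IS PROVED HERE (sorry-free).  All operators are honest `ℝ`-linear maps between the Euclidean spaces `BondSpace P` (η-lattice
bond fields), `PlaqSpace P` (plaquette fields), `CoarseSpace P j` (bond fields on `T^{(j)}`), `EuclideanSpace ℝ (Site P 0)` (gauge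
functions); `∂` on bond fields = p09's weighted curl `curlOp w c` (`w = η^d`, `c = η⁻¹`), `∂*` = its Hilbert-space adjoint
`LinearMap.adjoint (curlOp w c)` (plaquette sources → bond fields), `∂` on gauge functions = p11's `gradV1 P c`.
§1 `H_k` OF (4.4.2) IS LINEAR (abstract `LandauOps`; uniqueness clause of p11's `Hk_spec` + first-order condition): `Hk_add`,
   `Hk_smul`, `isLinearMap_Hk`; `linOf` packages a linear function as a `LinearMap`.
§2 THE OPERATORS: `HaxE` = H_{j,Ax} (p30's `HaxOp (V411 P j) ∂ Q^{s*}_j`), `CE` = C^{(j)} ((4.3.3), p30's `axialPropagator (Wstep P j)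
   (∂H_{j,Ax})`), `HkE` = H_j (the Landau minimizer `Hk (opsV1 P j c √w)` AS A LINEAR MAP: `HkE_apply`; `QcE_HkE`: Q_jH_j = I),
   `GaxE` = G_{k,Ax} := Σ_{j<k} H_{j,Ax}C^{(j)}H*_{j,Ax} — LITERALLY (5.2.2), and = p09's functional-integral propagator (4.1.1)
   `torusPropagator w c k` up to the pairing weight `w` (`torusPropagator_eq_GaxE`, by p30's Proposition 5.2.1 on the torus) —,
   `DkE` = 𝒟_k := Σ_{j<k} H_jC^{(j)}H_j* — LITERALLY (4.4.4) —, `D527E` = the D of (5.2.7).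
§3 (5.2.8): `curlOp_comp_HaxE` (∂H_{j,Ax} = ∂H_j, from p30's `eq528_torus`) and **`eq528_torus_adjoint`** (H*_{j,Ax}∂* = H*_j∂*).
§4 PROPOSITION 5.1.1 *"with k set equal to j"* for EVERY `B : CoarseSpace P j`: `HaxE_sub_HkE` (p30's abstract `prop511` at the
   V1 operators, representative Q^{s*}_jB, every hypothesis a torus theorem).
§5 **`eq529_torus`** ((5.2.9)); **`prop522_torus`** — THE OPERATOR IDENTITY (5.2.6) `G_{k,Ax}∂* − 𝒟_k∂* = ∂D` with the explicit
   (5.2.7), on all plaquette sources; `prop522_torus_apply` (the configuration form); `prop522_torusPropagator` (for p09's weighted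
   `torusPropagator`); **`eq5210_torus`** (Remark 1); and r15's carrier INSTANTIATED: `torusData522` (`Field := BondSpace P ×
   PlaqSpace P`, an operator `T∂*` acting as `(A, F) ↦ (T∂*F, 0)`, `onPlaq`) with **`prop522_torusData`** :
   `(torusData522 P w c k).Prop522`, `k ≤ m + K`, obtained from p11 gen 1's abstract `prop522_holds` (the printed proof) with its
   six hypotheses DISCHARGED by the torus theorems above.
Carrier clauses (F6): standing range of `Setup` (`k ≤ m + K`); `c ≠ 0`, `w > 0`.  New definitions: `linOf`, `HaxE`, `CE`, `HkE`,
`GaxE`, `DkE`, `D527E`, `onPlaq`, `torusData522` (operators / carriers only; no `def … : Prop`, no named fact).  Axioms: standard.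
-/

open scoped BigOperators RealInnerProductSpace

namespace Literature.MathematicalPhysics.QuantumFieldTheory.BalabanImbrieJaffe1984to88.BIJ85Prop522Torus

open MeasureTheory
open Literature.MathematicalPhysics.QuantumFieldTheory.Balaban1983to89
open BIJ85Sect2SurfaceAverages LatticeFieldCalculus BIJ85Eq219Proof BIJ85Eq531Inputs BIJ85AxialPropagator411
  BIJ85AxialMinimizer413 BIJ85Prop521Proof BIJ85Prop521Torus
open BIJ85LandauForm441 BIJ85LandauMinimizer442 BIJ85LandauMinimizer442V1 BIJ85Prop511Proof BIJ85Prop511Torus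
open BIJ85Sect4Statements BIJ85Prop522Proof
open BIJ85GaugeFunction5113 (lamOf)

noncomputable section

/-! ## §1  `H_k` of (4.4.2) is a linear operator (abstract `LandauOps`) -/

section LinOf

variable {M M₂ : Type*} [AddCommGroup M] [Module ℝ M] [AddCommGroup M₂] [Module ℝ M₂]

/-- The `ℝ`-linear map underlying a function KNOWN to be linear (and `0` for a non-linear function) — used to package the
Landau minimizer `B ↦ H_kB` of (4.4.2), a function defined by a Gaussian integral, as the operator `H_k` of (4.4.4)/(5.2.7).
[folklore] -/
def linOf (f : M → M₂) : M →ₗ[ℝ] M₂ := by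
  classical
  exact if h : IsLinearMap ℝ f then IsLinearMap.mk' f h else 0

/-- `linOf f = f` for a linear `f`. [folklore] -/
private theorem linOf_apply {f : M → M₂} (h : IsLinearMap ℝ f) (x : M) : linOf f x = f x := by
  unfold linOf
  rw [dif_pos h]
  exact IsLinearMap.mk'_apply h x

end LinOf

section Linear

variable {EA ES EP EB ES' : Type*}
  [NormedAddCommGroup EA] [InnerProductSpace ℝ EA] [FiniteDimensional ℝ EA] [MeasurableSpace EA] [BorelSpace EA]
  [NormedAddCommGroup ES] [InnerProductSpace ℝ ES] [FiniteDimensional ℝ ES] [MeasurableSpace ES] [BorelSpace ES]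
  [NormedAddCommGroup EP] [InnerProductSpace ℝ EP]
  [AddCommGroup EB] [Module ℝ EB] [AddCommGroup ES'] [Module ℝ ES']
  (D : LandauOps EA ES EP EB ES')

omit [FiniteDimensional ℝ EA] [MeasurableSpace EA] [BorelSpace EA] [MeasurableSpace ES] [BorelSpace ES] in
/-- the polar term `⟨∂A, ∂v⟩ + ⟨R∂*A, R∂*v⟩` of the quadratic form `E` of (4.4.2)–(4.4.3) is additive in `A`.
[cite: BalabanImbrieJaffe1985, (4.4.2) p.312] -/
theorem cross_add_left (A A' v : EA) : D.cross (A + A') v = D.cross A v + D.cross A' v := by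
  simp only [LandauOps.cross, map_add, inner_add_left]
  ring

omit [FiniteDimensional ℝ EA] [MeasurableSpace EA] [BorelSpace EA] [MeasurableSpace ES] [BorelSpace ES] in
/-- … and homogeneous in `A`. [cite: BalabanImbrieJaffe1985, (4.4.2) p.312] -/
theorem cross_smul_left (t : ℝ) (A v : EA) : D.cross (t • A) v = t * D.cross A v := by
  simp only [LandauOps.cross, map_smul, real_inner_smul_left]
  ring

omit [FiniteDimensional ℝ EA] [MeasurableSpace EA] [BorelSpace EA] [MeasurableSpace ES] [BorelSpace ES] in
/-- **first-order condition at the constrained minimizer, polar form** (p. 313 *"H_kB is the configuration which minimizes …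
subject to … the restriction Q_kA = B"*): at a minimizer `A₀` of `E` on the fibre `{Q_kA = B}` the polar term `cross(A₀, v)`
vanishes for every direction `v ∈ N(Q_k)`. [cite: BalabanImbrieJaffe1985, p.313 (text)] -/
theorem cross_eq_zero_of_isMinOn {B : EB} {A₀ : EA} (hA₀ : D.Qk A₀ = B) (hmin : IsMinOn D.energy (D.Fibre B) A₀)
    {v : EA} (hv : D.Qk v = 0) : D.cross A₀ v = 0 := by
  have h1 := D.energy_split_of_isMinOn hA₀ hmin hv
  have h2 := D.energy_add A₀ v
  linarith

omit [FiniteDimensional ℝ EA] [MeasurableSpace EA] [BorelSpace EA] [MeasurableSpace ES] [BorelSpace ES] in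
/-- … and conversely: a point of the fibre at which the polar term vanishes on `N(Q_k)` minimizes `E` on the fibre (`E ≥ 0` is a
quadratic form). [cite: BalabanImbrieJaffe1985, p.313 (text)] -/
theorem isMinOn_of_cross_eq_zero {B : EB} {A : EA} (hA : D.Qk A = B) (h : ∀ v : EA, D.Qk v = 0 → D.cross A v = 0) :
    IsMinOn D.energy (D.Fibre B) A := by
  rw [isMinOn_iff]
  intro A' hA'
  rw [LandauOps.mem_Fibre] at hA'
  have hv : D.Qk (A' - A) = 0 := by rw [map_sub, hA, hA', sub_self]
  have e := D.energy_add A (A' - A)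
  rw [add_sub_cancel, h _ hv, add_zero] at e
  rw [e]
  exact le_add_of_nonneg_right (D.energy_nonneg _)

/-- **`H_k` is additive**: `H_k(B₁ + B₂) = H_kB₁ + H_kB₂` — the sum of the minimizers lies on the fibre of `B₁ + B₂` and satisfies
the first-order condition there, so it IS the (unique, `Hk_spec`) minimizer (no zero modes `hZ`, «Δ invertible on N(Q′)» `hL`,
non-empty fibres `hB`); the adjoint `H_j*` in (4.4.4) presupposes this linearity. [cite: BalabanImbrieJaffe1985, (4.4.4) p.312] -/
theorem Hk_add (hZ : ∀ v : EA, D.Qk v = 0 → D.curl v = 0 → D.projR (D.dstar v) = 0 → v = 0)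
    (hL : ∀ l : ES, D.Qp l = 0 → D.lap l = 0 → l = 0) (hB : ∀ B : EB, ∃ A : EA, D.Qk A = B) (B₁ B₂ : EB) :
    Hk D (B₁ + B₂) = Hk D B₁ + Hk D B₂ := by
  obtain ⟨hQ1, hmin1, -, -⟩ := Hk_spec D hZ hL (hB B₁)
  obtain ⟨hQ2, hmin2, -, -⟩ := Hk_spec D hZ hL (hB B₂)
  obtain ⟨-, -, -, huniq⟩ := Hk_spec D hZ hL (hB (B₁ + B₂))
  have hQ : D.Qk (Hk D B₁ + Hk D B₂) = B₁ + B₂ := by rw [map_add, hQ1, hQ2]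
  refine (huniq _ hQ (isMinOn_of_cross_eq_zero D hQ fun v hv => ?_)).symm
  rw [cross_add_left, cross_eq_zero_of_isMinOn D hQ1 hmin1 hv, cross_eq_zero_of_isMinOn D hQ2 hmin2 hv, add_zero]

/-- **`H_k` is homogeneous**: `H_k(tB) = tH_kB` (same argument). [cite: BalabanImbrieJaffe1985, (4.4.4) p.312] -/
theorem Hk_smul (hZ : ∀ v : EA, D.Qk v = 0 → D.curl v = 0 → D.projR (D.dstar v) = 0 → v = 0)
    (hL : ∀ l : ES, D.Qp l = 0 → D.lap l = 0 → l = 0) (hB : ∀ B : EB, ∃ A : EA, D.Qk A = B) (t : ℝ) (B : EB) :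
    Hk D (t • B) = t • Hk D B := by
  obtain ⟨hQ1, hmin1, -, -⟩ := Hk_spec D hZ hL (hB B)
  obtain ⟨-, -, -, huniq⟩ := Hk_spec D hZ hL (hB (t • B))
  have hQ : D.Qk (t • Hk D B) = t • B := by rw [map_smul, hQ1]
  refine (huniq _ hQ (isMinOn_of_cross_eq_zero D hQ fun v hv => ?_)).symm
  rw [cross_smul_left, cross_eq_zero_of_isMinOn D hQ1 hmin1 hv, mul_zero]

/-- **`H_k` of (4.4.2) is a linear operator** (the `H_k` of (4.4.4) *"𝒟_k = Σ_{j=0}^{k−1} H_jC^{(j)}H_j*"*).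
[cite: BalabanImbrieJaffe1985, (4.4.4) p.312] -/
theorem isLinearMap_Hk (hZ : ∀ v : EA, D.Qk v = 0 → D.curl v = 0 → D.projR (D.dstar v) = 0 → v = 0)
    (hL : ∀ l : ES, D.Qp l = 0 → D.lap l = 0 → l = 0) (hB : ∀ B : EB, ∃ A : EA, D.Qk A = B) :
    IsLinearMap ℝ (Hk D) :=
  ⟨Hk_add D hZ hL hB, Hk_smul D hZ hL hB⟩

end Linear

/-! ## §2  The operators of (5.2.2), (4.4.4), (5.2.7) on the torus `T^{(0)}` -/

variable {P : Params}

/-- the identification `BondSpace P → VecField P 0 ℝ` is `WithLp.ofLp`. [folklore] -/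
private theorem toE_symm_apply' (v : BondSpace P) : (toE P).symm v = WithLp.ofLp v := rfl

/-- the identification `VecField P 0 ℝ → BondSpace P` is `WithLp.toLp`. [folklore] -/
private theorem toE_apply' (A : VecField P 0 ℝ) : toE P A = WithLp.toLp 2 A := rfl

/-- the identification `CoarseSpace P j → VecField P j ℝ` is `WithLp.ofLp`. [folklore] -/
private theorem toEj_symm_apply' (j : ℕ) (B : CoarseSpace P j) : (toEj P j).symm B = WithLp.ofLp B := rfl

/-- the identification `VecField P j ℝ → CoarseSpace P j` is `WithLp.toLp`. [folklore] -/
private theorem toEj_apply' (j : ℕ) (B : VecField P j ℝ) : toEj P j B = WithLp.toLp 2 B := rfl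

/-- p09's weighted curl unfolded: `∂v = √w · curl c v` componentwise. [cite: BalabanImbrieJaffe1985, (4.1.1) p.309] -/
private theorem curlOp_apply' (w c : ℝ) (v : BondSpace P) :
    curlOp (P := P) w c v = Real.sqrt w • WithLp.toLp 2 (curl c (WithLp.ofLp v)) := by
  rw [curlOp_eq_opsV1_curl 0 w c, opsV1_curl]

/-- **p. 309, no zero modes on `δ(Q_kA)δ_{k,Ax}(A)`**, in the shape of p09/p30's hypothesis `hD` on the Euclidean carrier, for
`k ≤ m + K`, `c ≠ 0`, `w > 0` (p30's `BIJ85Prop511Torus.noZeroModes_axialE`; also p33's `BIJ85NoZeroModes309Torus.hD_holds`).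
[cite: BalabanImbrieJaffe1985, p.309 (text)] -/
theorem hD_V411 {k : ℕ} (hk : k ≤ P.m + P.K) {c : ℝ} (hc : c ≠ 0) {w : ℝ} (hw : 0 < w) :
    ∀ v : V411 P k, curlOp (P := P) w c (v : BondSpace P) = 0 → v = 0 := by
  intro v hv
  have hs : Real.sqrt w ≠ 0 := (Real.sqrt_pos.2 hw).ne'
  obtain ⟨hQ, hax⟩ := (mem_V411_iff k c (Real.sqrt w) (v : BondSpace P)).1 v.2
  rw [curlOp_eq_opsV1_curl k w c] at hv
  exact (Submodule.coe_eq_zero).1 (noZeroModes_axialE hk hc hs hQ hax hv)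

variable (P) in
/-- **`H_{j,Ax}`** — the axial-gauge minimizer (4.1.3)/(5.3.1) as a linear map of the `T^{(j)}`-field `B` (p30's `HaxOp` at the
torus data: constraint subspace `V411 P j` = `δ(Q_jA)δ_{j,Ax}(A)`, `∂ = curlOp w c`, representative map `Q^{s*}_j = QsE P j`).
[cite: BalabanImbrieJaffe1985, (4.1.3) p.310] -/
def HaxE (w c : ℝ) (j : ℕ) : CoarseSpace P j →ₗ[ℝ] BondSpace P :=
  HaxOp (V411 P j) (curlOp (P := P) w c) (QsE P j)

variable (P) in
/-- **`C^{(j)}`** — the unit-lattice propagator (4.3.3) on `T^{(j)}` in p30's operator form (`axialPropagator` of the constraint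
subspace `δ(QB)δ_{Ax}(B)` = `Wstep P j` for the quadratic form `½‖∂H_{j,Ax}B‖²`). [cite: BalabanImbrieJaffe1985, (4.3.3) p.311] -/
def CE (w c : ℝ) (j : ℕ) : CoarseSpace P j →ₗ[ℝ] CoarseSpace P j :=
  axialPropagator (Wstep P j) (curlOp (P := P) w c ∘ₗ HaxE P w c j)

variable (P) in
/-- **`H_j`** — the Landau-gauge minimizer (4.4.2) `H_jB = Hk (opsV1 P j c √w) B` of p11 (V1 operators: `∂ = √w·curl c`, `∂*`, `Δ`,
`Q_j`, `Q′_j` on `T^{(0)}`) AS A LINEAR OPERATOR `T^{(j)}`-fields → η-lattice bond fields (linear by §1 in the standing range: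
`HkE_apply`). [cite: BalabanImbrieJaffe1985, (4.4.2) p.312] -/
def HkE (w c : ℝ) (j : ℕ) : CoarseSpace P j →ₗ[ℝ] BondSpace P :=
  linOf (Hk (opsV1 P j c (Real.sqrt w))) ∘ₗ (toEj P j).symm.toLinearMap

/-- `HkE` IS the Landau minimizer: `H_jB = Hk (opsV1 P j c √w) B` for `j ≤ m + K`, `c ≠ 0`, `w > 0` (linearity: `isLinearMap_Hk`
with p11's `noZeroModes_V1`, `lapInjective_V1`, `fibre_nonempty_V1`). [cite: BalabanImbrieJaffe1985, (4.4.2) p.312] -/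
theorem HkE_apply {j : ℕ} (hj : j ≤ P.m + P.K) {c : ℝ} (hc : c ≠ 0) {w : ℝ} (hw : 0 < w) (B : CoarseSpace P j) :
    HkE P w c j B = Hk (opsV1 P j c (Real.sqrt w)) (WithLp.ofLp B) := by
  have hs : Real.sqrt w ≠ 0 := (Real.sqrt_pos.2 hw).ne'
  unfold HkE
  rw [LinearMap.comp_apply, LinearEquiv.coe_toLinearMap, toEj_symm_apply',
    linOf_apply (isLinearMap_Hk (opsV1 P j c (Real.sqrt w)) (noZeroModes_V1 hj hc hs)
      (fun l => lapInjective_V1 j hc hs l) (fibre_nonempty_V1 hj c _))]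

/-- **`Q_jH_j = I`**: the Landau minimizer lies on the fibre `{Q_jA = B}` (p11's `Hk_spec_V1`; cf. (4.1.5) *"by definition
Q_kH_{k,Ax}B = B"*). [cite: BalabanImbrieJaffe1985, (4.4.2) p.312] -/
theorem QcE_HkE {j : ℕ} (hj : j ≤ P.m + P.K) {c : ℝ} (hc : c ≠ 0) {w : ℝ} (hw : 0 < w) (B : CoarseSpace P j) :
    QcE P j (HkE P w c j B) = B := by
  have hs : Real.sqrt w ≠ 0 := (Real.sqrt_pos.2 hw).ne'
  have h := (Hk_spec_V1 hj hc hs (WithLp.ofLp B)).1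
  rw [opsV1_Qk] at h
  rw [HkE_apply hj hc hw, QcE_apply, toE_symm_apply', h, toEj_apply', WithLp.toLp_ofLp]

/-- `H_{j,Ax}B` read as a bond function is p09's torus minimizer at the representative `Q^{s*}_jB` (p30's `HaxOp_torus`).
[cite: BalabanImbrieJaffe1985, (4.1.3) p.310] -/
theorem ofLp_HaxE {j : ℕ} (hj : j ≤ P.m + P.K) {c : ℝ} (hc : c ≠ 0) {w : ℝ} (hw : 0 < w) (B : CoarseSpace P j) :
    WithLp.ofLp (HaxE P w c j B) = torusHax w c j (QsstarIter j (WithLp.ofLp B)) := by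
  have h := HaxOp_torus c (hD_V411 hj hc hw) (WithLp.ofLp B)
  rw [toEj_apply', WithLp.toLp_ofLp, toE_symm_apply'] at h
  exact h

variable (P) in
/-- **`G_{k,Ax}` as the sum (5.2.2)**, verbatim *"G_{k,Ax} = Σ_{j=0}^{k−1} H_{j,Ax}C^{(j)}H*_{j,Ax}. (5.2.2)"* (`H*` = the Hilbert-space
adjoint on the Euclidean carriers); equal to p09's functional-integral propagator (4.1.1) up to the weight of the pairing,
`torusPropagator_eq_GaxE` (= Proposition 5.2.1 on the torus, p30). [cite: BalabanImbrieJaffe1985, (5.2.2) p.316] -/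
def GaxE (w c : ℝ) (k : ℕ) : BondSpace P →ₗ[ℝ] BondSpace P :=
  ∑ j ∈ Finset.range k, HaxE P w c j ∘ₗ CE P w c j ∘ₗ LinearMap.adjoint (HaxE P w c j)

variable (P) in
/-- **`𝒟_k`**, verbatim (4.4.4): *"𝒟_k = Σ_{j=0}^{k−1} H_jC^{(j)}H_j*. (4.4.4)"*, with `H_j` the Landau minimizer (4.4.2) as an operator
(`HkE`) and `C^{(j)}` of (4.3.3) (`CE`). [cite: BalabanImbrieJaffe1985, (4.4.4) p.312] -/
def DkE (w c : ℝ) (k : ℕ) : BondSpace P →ₗ[ℝ] BondSpace P :=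
  ∑ j ∈ Finset.range k, HkE P w c j ∘ₗ CE P w c j ∘ₗ LinearMap.adjoint (HkE P w c j)

variable (P) in
/-- **the gauge transformation `D` of (5.2.7)**, verbatim: *"D = Σ_{j=0}^{k−1} λ_j(H_jC^{(j)}H_j*∂*), (5.2.7) where λ_j is the function
of Proposition 5.1.1 with k set equal to j"* — `λ_j` = p08's gauge function `lamOf c j` on the Euclidean carrier (p30's `lamE P c j`),
`∂*` = `LinearMap.adjoint (curlOp w c)`; a linear map plaquette sources → gauge functions. [cite: BalabanImbrieJaffe1985, (5.2.7) p.316] -/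
def D527E (w c : ℝ) (k : ℕ) : PlaqSpace P →ₗ[ℝ] EuclideanSpace ℝ (Site P 0) :=
  ∑ j ∈ Finset.range k, lamE P c j ∘ₗ HkE P w c j ∘ₗ CE P w c j ∘ₗ LinearMap.adjoint (HkE P w c j)
    ∘ₗ LinearMap.adjoint (curlOp (P := P) w c)

/-- unfolding `D` at a plaquette source. [cite: BalabanImbrieJaffe1985, (5.2.7) p.316] -/
theorem D527E_apply (w c : ℝ) (k : ℕ) (F : PlaqSpace P) :
    D527E P w c k F = ∑ j ∈ Finset.range k, lamE P c j (HkE P w c j (CE P w c j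
      (LinearMap.adjoint (HkE P w c j) (LinearMap.adjoint (curlOp (P := P) w c) F)))) := by
  simp only [D527E, LinearMap.sum_apply, LinearMap.coe_comp, Function.comp_apply]

/-- **`G_{k,Ax}` of (4.1.1) IS the sum (5.2.2)** for p09's weighted torus propagator: `torusPropagator w c k = w·ι⁻¹ ∘ GaxE ∘ ι`
(`w = η^d` the weight of the pairing `⟨A, J⟩ = Σ_b η^dA_bJ_b`), `k ≤ m + K`, `c ≠ 0`, `w > 0` — p30's `torusPropagator_eq_sum`
(Proposition 5.2.1 iterated) with the p. 309 input `hD_V411`. [cite: BalabanImbrieJaffe1985, Prop. 5.2.1 (5.2.2) p.316] -/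
theorem torusPropagator_eq_GaxE {k : ℕ} (hk : k ≤ P.m + P.K) {c : ℝ} (hc : c ≠ 0) {w : ℝ} (hw : 0 < w) :
    torusPropagator w c k = w • ((toE P).symm.toLinearMap ∘ₗ GaxE P w c k ∘ₗ (toE P).toLinearMap) := by
  rw [torusPropagator_eq_sum c hk (hD_V411 hk hc hw)]
  apply LinearMap.ext
  intro A
  simp only [GaxE, HaxE, CE, LinearMap.sum_apply, LinearMap.smul_apply, LinearMap.coe_comp, Function.comp_apply,
    LinearEquiv.coe_toLinearMap, map_sum, Finset.smul_sum]

/-! ## §3  (5.2.8) on the torus, operator forms -/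

/-- **(5.2.8) on `T^{(0)}`, operator form `∂H_{j,Ax} = ∂H_j`** (p. 316: *"the fact that H*_{j,Ax}∂* = H_j*∂*, (5.2.8) is gauge
invariant"*): the axial and the Landau minimizers have the same plaquette field for every `B` — p30's configuration form
`eq528_torus` at the representative `Q^{s*}_jB` (`j ≤ m + K`, `c ≠ 0`, `w > 0`). [cite: BalabanImbrieJaffe1985, (5.2.8) p.316] -/
theorem curlOp_comp_HaxE {j : ℕ} (hj : j ≤ P.m + P.K) {c : ℝ} (hc : c ≠ 0) {w : ℝ} (hw : 0 < w) :
    curlOp (P := P) w c ∘ₗ HaxE P w c j = curlOp (P := P) w c ∘ₗ HkE P w c j := by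
  apply LinearMap.ext
  intro B
  rw [LinearMap.comp_apply, LinearMap.comp_apply, curlOp_apply', curlOp_apply', ofLp_HaxE hj hc hw, HkE_apply hj hc hw]
  congr 2
  funext p
  exact eq528_torus hj hc hw (bondAvgIter_QsstarIter hj _) (deltaAx_QsstarIter hj _) p

/-- **(5.2.8) on `T^{(0)}` VERBATIM: `H*_{j,Ax}∂* = H_j*∂*`** — adjoint of `curlOp_comp_HaxE` (`(ST)* = T*S*`).
[cite: BalabanImbrieJaffe1985, (5.2.8) p.316] -/
theorem eq528_torus_adjoint {j : ℕ} (hj : j ≤ P.m + P.K) {c : ℝ} (hc : c ≠ 0) {w : ℝ} (hw : 0 < w) :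
    LinearMap.adjoint (HaxE P w c j) ∘ₗ LinearMap.adjoint (curlOp (P := P) w c) =
      LinearMap.adjoint (HkE P w c j) ∘ₗ LinearMap.adjoint (curlOp (P := P) w c) := by
  rw [← LinearMap.adjoint_comp, ← LinearMap.adjoint_comp, curlOp_comp_HaxE hj hc hw]

/-! ## §4  Proposition 5.1.1 "with k set equal to j", operator form -/

/-- **Proposition 5.1.1 with `k := j` as an identity of maps of the `T^{(j)}`-field `B`** ((5.1.1) *"H_{k,Ax}B − H_kB = ∂λ"* with
the λ of (5.1.4) = `λ_j(H_jB)`): `H_{j,Ax}B − H_jB = ∂λ_j(H_jB)` for EVERY `B : CoarseSpace P j` (`j ≤ m + K`, `c ≠ 0`, `w > 0`) —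
p30's abstract `BIJ85Prop511Proof.prop511` at the V1 operators, the axial representative being `Q^{s*}_jB` (`Q_jQ^{s*}_j = I`,
`δ_{j,Ax}(Q^{s*}_jB)`: p09's `bondAvgIter_QsstarIter`, `deltaAx_QsstarIter`), every hypothesis a torus theorem
(`noZeroModes_V1`, `lapInjective_V1`, `gaugeStructure_V1`, `mem_V411_iff`, `lamE_Qp`, `lamE_axial`, `lamE_unique`).
[cite: BalabanImbrieJaffe1985, Prop. 5.1.1 p.314] -/
theorem HaxE_sub_HkE {j : ℕ} (hj : j ≤ P.m + P.K) {c : ℝ} (hc : c ≠ 0) {w : ℝ} (hw : 0 < w) (B : CoarseSpace P j) :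
    HaxE P w c j B - HkE P w c j B = gradV1 P c (lamE P c j (HkE P w c j B)) := by
  have hs : Real.sqrt w ≠ 0 := (Real.sqrt_pos.2 hw).ne'
  have hD := hD_V411 hj hc hw
  have hA₀ : (opsV1 P j c (Real.sqrt w)).Qk (QsE P j B) = WithLp.ofLp B := by
    rw [opsV1_Qk, QsE_apply, toEj_symm_apply', toE_apply', WithLp.ofLp_toLp, bondAvgIter_QsstarIter hj]
  have hA₀Ax : QsE P j B ∈ axialE P j := by
    rw [mem_axialE, QsE_apply, toEj_symm_apply', toE_apply', WithLp.ofLp_toLp]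
    exact deltaAx_QsstarIter hj _
  have h := prop511 (opsV1 P j c (Real.sqrt w)) (noZeroModes_V1 hj hc hs) (fun l => lapInjective_V1 j hc hs l)
    (gaugeStructure_V1 hj c (Real.sqrt w)) (Ax := axialE P j) (V := V411 P j) (fun v => mem_V411_iff j c (Real.sqrt w) v)
    (lamE P c j) (fun v => lamE_Qp hj c (Real.sqrt w) v) (fun v => lamE_axial hj hc v)
    (fun A μ hμ hax => lamE_unique hj hc (Real.sqrt w) A μ hμ hax) hA₀ hA₀Ax
  rw [HkE_apply hj hc hw, ← h]
  congr 1
  show HaxOp (V411 P j) (curlOp (P := P) w c) (QsE P j) B = _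
  rw [HaxOp_apply hD, curlOp_eq_opsV1_curl j w c]

/-! ## §5  (5.2.9), Proposition 5.2.2 (5.2.6)–(5.2.7), Remark 1 (5.2.10) on the torus -/

/-- **(5.2.9) on `T^{(0)}`**, verbatim *"G_{k,Ax}∂* − 𝒟_k∂* = Σ_{j=0}^{k−1} (H_{j,Ax} − H_j)C^{(j)}H_j*∂*. (5.2.9)"* — from (5.2.2)
(the definition of `GaxE`), (4.4.4) (`DkE`) and (5.2.8) (`eq528_torus_adjoint`, `j < k ≤ m + K`); applied to a plaquette source `J`.
[cite: BalabanImbrieJaffe1985, (5.2.9) p.317] -/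
theorem eq529_torus {k : ℕ} (hk : k ≤ P.m + P.K) {c : ℝ} (hc : c ≠ 0) {w : ℝ} (hw : 0 < w) (J : PlaqSpace P) :
    GaxE P w c k (LinearMap.adjoint (curlOp (P := P) w c) J) - DkE P w c k (LinearMap.adjoint (curlOp (P := P) w c) J) =
      ∑ j ∈ Finset.range k, (HaxE P w c j - HkE P w c j)
        (CE P w c j (LinearMap.adjoint (HkE P w c j) (LinearMap.adjoint (curlOp (P := P) w c) J))) := by
  simp only [GaxE, DkE, LinearMap.sum_apply, LinearMap.coe_comp, Function.comp_apply, LinearMap.sub_apply]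
  rw [← Finset.sum_sub_distrib]
  refine Finset.sum_congr rfl fun j hj => ?_
  have hj' : j ≤ P.m + P.K := by
    have := Finset.mem_range.mp hj
    omega
  have h528 := LinearMap.congr_fun (eq528_torus_adjoint hj' hc hw) J
  simp only [LinearMap.coe_comp, Function.comp_apply] at h528
  rw [h528]

/-- **Proposition 5.2.2 on `T^{(0)}`** (p. 316, verbatim: *"There is a gauge transformation D such that G_{k,Ax}∂* − 𝒟_k∂* = ∂D.
(5.2.6) Explicitly D = Σ_{j=0}^{k−1} λ_j(H_jC^{(j)}H_j*∂*), (5.2.7) … Here we write the operator identity"*), HYPOTHESIS-FREE in the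
standing range: for `k ≤ m + K`, `c ≠ 0` (lattice factor `c = η⁻¹`), `w > 0` (weight `η^d`), THE OPERATOR IDENTITY
`G_{k,Ax}∂* − 𝒟_k∂* = ∂D` between linear maps plaquette sources → η-lattice bond fields, with `G_{k,Ax}` = (5.2.2) (`GaxE`; = (4.1.1) by
`torusPropagator_eq_GaxE`), `𝒟_k` = (4.4.4) (`DkE`), `∂*` = `LinearMap.adjoint (curlOp w c)`, `∂` on gauge functions = `gradV1 P c`
and `D` = (5.2.7) (`D527E`).  Printed proof: (5.2.9) (`eq529_torus`), then Proposition 5.1.1 with `k := j` (`HaxE_sub_HkE`) and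
*"Substitution"* (linearity of `∂`). [cite: BalabanImbrieJaffe1985, Prop. 5.2.2 (5.2.6) p.316] -/
theorem prop522_torus {k : ℕ} (hk : k ≤ P.m + P.K) {c : ℝ} (hc : c ≠ 0) {w : ℝ} (hw : 0 < w) :
    GaxE P w c k ∘ₗ LinearMap.adjoint (curlOp (P := P) w c) - DkE P w c k ∘ₗ LinearMap.adjoint (curlOp (P := P) w c) =
      gradV1 P c ∘ₗ D527E P w c k := by
  apply LinearMap.ext
  intro J
  rw [LinearMap.sub_apply, LinearMap.comp_apply, LinearMap.comp_apply, eq529_torus hk hc hw J, LinearMap.comp_apply,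
    D527E_apply, map_sum]
  refine Finset.sum_congr rfl fun j hj => ?_
  have hj' : j ≤ P.m + P.K := by
    have := Finset.mem_range.mp hj
    omega
  rw [LinearMap.sub_apply]
  exact HaxE_sub_HkE hj' hc hw _

/-- **Proposition 5.2.2 on `T^{(0)}`, configuration form** (p. 316: *"the identity G_{k,Ax}∂*B = 𝒟_k∂*B + ∂DB for configurations"*),
for every plaquette source. [cite: BalabanImbrieJaffe1985, Prop. 5.2.2 (5.2.6) p.316] -/
theorem prop522_torus_apply {k : ℕ} (hk : k ≤ P.m + P.K) {c : ℝ} (hc : c ≠ 0) {w : ℝ} (hw : 0 < w) (J : PlaqSpace P) :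
    GaxE P w c k (LinearMap.adjoint (curlOp (P := P) w c) J) =
      DkE P w c k (LinearMap.adjoint (curlOp (P := P) w c) J) + gradV1 P c (D527E P w c k J) := by
  have h := LinearMap.congr_fun (prop522_torus hk hc hw) J
  simp only [LinearMap.sub_apply, LinearMap.coe_comp, Function.comp_apply] at h
  rw [← h, add_sub_cancel]

/-- **Proposition 5.2.2 for p09's weighted torus propagator (4.1.1)** (pairing `⟨A, J⟩ = Σ_b η^dA_bJ_b`, `w = η^d`): on bond functions,
`G_{k,Ax}(∂*J) − w·𝒟_k(∂*J) = w·∂(DJ)` with `G_{k,Ax} = torusPropagator w c k`, `∂` = the tree's `grad c`.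
[cite: BalabanImbrieJaffe1985, Prop. 5.2.2 (5.2.6) p.316] -/
theorem prop522_torusPropagator {k : ℕ} (hk : k ≤ P.m + P.K) {c : ℝ} (hc : c ≠ 0) {w : ℝ} (hw : 0 < w) (J : PlaqSpace P) :
    torusPropagator w c k (WithLp.ofLp (LinearMap.adjoint (curlOp (P := P) w c) J))
        - w • WithLp.ofLp (DkE P w c k (LinearMap.adjoint (curlOp (P := P) w c) J)) =
      w • grad c (WithLp.ofLp (D527E P w c k J)) := by
  rw [torusPropagator_eq_GaxE hk hc hw, LinearMap.smul_apply, LinearMap.comp_apply, LinearMap.comp_apply,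
    LinearEquiv.coe_toLinearMap, LinearEquiv.coe_toLinearMap, toE_apply', WithLp.toLp_ofLp, toE_symm_apply',
    prop522_torus_apply hk hc hw J, WithLp.ofLp_add, smul_add, add_sub_cancel_left, gradV1_apply, WithLp.ofLp_toLp]

/-- **Remark 1, (5.2.10) on `T^{(0)}`**, verbatim *"A consequence of the proposition is ∂G_{k,Ax}∂* = ∂𝒟_k∂*. (5.2.10)"* — from
`prop522_torus` and `∂∂λ = 0` (p11's `gaugeStructure_V1`; `curlOp w c = (opsV1 P k c √w).curl`, p30's `curlOp_eq_opsV1_curl`);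
`k ≤ m + K`, `c ≠ 0`, `w > 0`. [cite: BalabanImbrieJaffe1985, (5.2.10) p.317] -/
theorem eq5210_torus {k : ℕ} (hk : k ≤ P.m + P.K) {c : ℝ} (hc : c ≠ 0) {w : ℝ} (hw : 0 < w) :
    curlOp (P := P) w c ∘ₗ GaxE P w c k ∘ₗ LinearMap.adjoint (curlOp (P := P) w c) =
      curlOp (P := P) w c ∘ₗ DkE P w c k ∘ₗ LinearMap.adjoint (curlOp (P := P) w c) := by
  apply LinearMap.ext
  intro J
  simp only [LinearMap.coe_comp, Function.comp_apply]
  rw [prop522_torus_apply hk hc hw J, map_add, curlOp_eq_opsV1_curl k w c,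
    (gaugeStructure_V1 hk c (Real.sqrt w)).curl_grad, add_zero]

/-! ### The instance of r15's carrier `Prop522Data` (decl of record `Prop522Data.Prop522`) -/

variable (P) in
/-- an operator `T∂*` (plaquette sources → bond fields) acting on r15's single sort of sources, instantiated as the pairs
`(A, F) ∈ BondSpace P × PlaqSpace P`: `(A, F) ↦ (T∂*F, 0)` (only the plaquette component is a source of `T∂*`; cf. p. 316 *"we need
only the compositions 𝒟_k∂* and G_{k,Ax}∂*, since only these products occur"*). [cite: BalabanImbrieJaffe1985, Prop. 5.2.2 p.316] -/
def onPlaq (T : PlaqSpace P →ₗ[ℝ] BondSpace P) : BondSpace P × PlaqSpace P → BondSpace P × PlaqSpace P :=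
  fun J => (T J.2, 0)

variable (P) in
/-- **r15's carrier `Prop522Data` ON THE TORUS**: `k` the scale; `Field := BondSpace P × PlaqSpace P` (bond fields and plaquette
sources in one sort); `Gauge` := gauge functions on `T^{(0)}`; `grad` := `(∂λ, 0)` with `∂ = gradV1 P c`; `GaxDs` := `G_{k,Ax}∂*`,
`DkDs` := `𝒟_k∂*`, `HCHDs j` := `H_jC^{(j)}H_j*∂*` (each acting by `onPlaq`), `lamOp j T` := `λ_j ∘ T` read on the bond component
(`λ_j = lamE P c j`, p08's (5.1.13) gauge function). [cite: BalabanImbrieJaffe1985, Prop. 5.2.2 p.316] -/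
@[reducible] def torusData522 (w c : ℝ) (k : ℕ) : Prop522Data where
  k := k
  Field := BondSpace P × PlaqSpace P
  Gauge := EuclideanSpace ℝ (Site P 0)
  grad := (LinearMap.inl ℝ (BondSpace P) (PlaqSpace P) ∘ₗ gradV1 P c).toAddMonoidHom
  GaxDs := onPlaq P (GaxE P w c k ∘ₗ LinearMap.adjoint (curlOp (P := P) w c))
  DkDs := onPlaq P (DkE P w c k ∘ₗ LinearMap.adjoint (curlOp (P := P) w c))
  HCHDs := fun j => onPlaq P (HkE P w c j ∘ₗ CE P w c j ∘ₗ LinearMap.adjoint (HkE P w c j)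
    ∘ₗ LinearMap.adjoint (curlOp (P := P) w c))
  lamOp := fun j T J => lamE P c j (T J).1

/-- the carrier's `D` of (5.2.7) (`Prop522Data.D527`) at the torus data is `D527E` on the plaquette component.
[cite: BalabanImbrieJaffe1985, (5.2.7) p.316] -/
theorem torusData522_D527 (w c : ℝ) (k : ℕ) (J : BondSpace P × PlaqSpace P) :
    (torusData522 P w c k).D527 J = D527E P w c k J.2 := by
  rw [D527E_apply]
  rfl

/-- **row C1.Prop5.2.2's decl of record INHABITED on the torus**: `(torusData522 P w c k).Prop522` — Proposition 5.2.2 in r15's typed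
form `∀ J, GaxDs J − DkDs J = grad (D527 J)` HOLDS for the torus data, `k ≤ m + K`, `c ≠ 0`, `w > 0`, BY p11 gen 1's abstract proof
`BIJ85Prop522Proof.prop522_holds` (the printed proof p. 316–317) with its six hypotheses DISCHARGED by the torus theorems:
`h522` = (5.2.2) (the definition of `GaxE`), `h444` = (4.4.4) (`DkE`), `h528` = (5.2.8) (`eq528_torus_adjoint`), `hHCH` = the carrier's
composed operator, `h511` = Proposition 5.1.1 with `k := j` (`HaxE_sub_HkE`), `hlam` = the carrier's `λ_j(T)` is `λ_j ∘ T`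
(on the plaquette component this is `prop522_torus_apply`, cf. `torusData522_D527`). [cite: BalabanImbrieJaffe1985, Prop. 5.2.2 (5.2.6) p.316] -/
theorem prop522_torusData {k : ℕ} (hk : k ≤ P.m + P.K) {c : ℝ} (hc : c ≠ 0) {w : ℝ} (hw : 0 < w) :
    (torusData522 P w c k).Prop522 := by
  refine prop522_holds (torusData522 P w c k) (V := fun j => CoarseSpace P j)
    (fun j B => ((HaxE P w c j B, 0) : BondSpace P × PlaqSpace P))
    (fun j B => ((HkE P w c j B, 0) : BondSpace P × PlaqSpace P))
    (fun j => CE P w c j)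
    (fun j J => LinearMap.adjoint (HaxE P w c j) (LinearMap.adjoint (curlOp (P := P) w c) J.2))
    (fun j J => LinearMap.adjoint (HkE P w c j) (LinearMap.adjoint (curlOp (P := P) w c) J.2))
    (fun j A => lamE P c j A.1) ?_ ?_ ?_ ?_ ?_ ?_
  · -- h522: (5.2.2)
    intro J
    refine Prod.ext ?_ ?_
    · simp only [onPlaq, GaxE, LinearMap.coe_comp, Function.comp_apply, LinearMap.sum_apply, Prod.fst_sum]
    · simp only [onPlaq, Prod.snd_sum, Finset.sum_const_zero]
  · -- h444: (4.4.4)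
    intro J
    refine Prod.ext ?_ ?_
    · simp only [onPlaq, DkE, LinearMap.coe_comp, Function.comp_apply, LinearMap.sum_apply, Prod.fst_sum]
    · simp only [onPlaq, Prod.snd_sum, Finset.sum_const_zero]
  · -- h528: (5.2.8)
    intro j hj J
    have hj' : j ≤ P.m + P.K := le_trans (le_of_lt hj) hk
    have h := LinearMap.congr_fun (eq528_torus_adjoint hj' hc hw) J.2
    simp only [LinearMap.coe_comp, Function.comp_apply] at h
    exact h
  · -- hHCH: the carrier's H_jC^{(j)}H_j*∂*
    intro j _ J
    rfl
  · -- h511: Proposition 5.1.1 with k := j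
    intro j hj B
    have hj' : j ≤ P.m + P.K := le_trans (le_of_lt hj) hk
    refine Prod.ext ?_ ?_
    · simp only [Prod.fst_sub, LinearMap.toAddMonoidHom_coe, LinearMap.coe_comp, Function.comp_apply, LinearMap.inl_apply]
      exact HaxE_sub_HkE hj' hc hw B
    · simp only [Prod.snd_sub, sub_zero, LinearMap.toAddMonoidHom_coe, LinearMap.coe_comp, Function.comp_apply,
        LinearMap.inl_apply]
  · -- hlam: λ_j(T) = λ_j ∘ T
    intro j _ J
    rfl

end

end Literature.MathematicalPhysics.QuantumFieldTheory.BalabanImbrieJaffe1984to88.BIJ85Prop522Torus
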